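import Literature.AlgebraicGeometry.Motives.AbelianVarietyCotangentSheafFreeHolds
import Literature.AlgebraicGeometry.Motives.HodgeSheavesFree
import Literature.AlgebraicGeometry.HodgeTheory.AtiyahClassCoherent
import Literature.AlgebraicGeometry.Modules.SheafHomFrames
import Literature.AlgebraicGeometry.Modules.IsoOfFrames
import HarnessLib

/-!
# The tangent sheaf of an abelian variety is free of rank `dim A`: `𝒯_{A/k} = (Ω¹_{A/k})^∨ ≅ 𝒪_A^{dim A}`

Topic `AlgebraicGeometry/Motives`; namespaces `Literature.AlgebraicGeometry.Modules` (the generic duality lemma) and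
`Literature.AlgebraicGeometry.Motives.AbelianVariety` (the abelian-variety statements).  THEOREMS ONLY: no definition,
no named fact, no instance, no `sorry`.  Cell hodgecm-mathlib (D-0151), count-neutral capital for node E2 of
`B-plan/F-census/SOCKETS-F.md` §4 (α) «EQUIDIM by proof» (first-order deformations of an abelian variety:
`Def_A(k[ε]) ≅ H¹(A, 𝒯_A) ≅ H¹(A, 𝒪_A) ⊗ Lie A` — this file supplies the factor `𝒯_A ≅ 𝒪_A ⊗_k Lie A`, i.e.
`𝒯_A` globally free of rank `g = dim A`).  HC_CM is proved only modulo the 7 printed citations until rung 0 closes.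

[MumfordAV1970] §4 (iii) (p. 42): «`Ω¹_X` is a free `𝒪_X`-module generated by the invariant differentials» — for the tree's
abelian varieties over a field this is ★ `Mumford1970_cotangentSheaf_abelianVariety_free_holds`
(`Motives/AbelianVarietyCotangentSheafFreeHolds`).  The tangent sheaf is the dual `𝒯_{X/S} = 𝓗om(Ω¹_{X/S}, 𝒪_X)`
([Hartshorne1977] II.8, p. 180; tree `HodgeTheory.tangentSheaf`, `AtiyahClassCoherent`), and the dual of a free module
of finite rank is free of the same rank on the dual basis ([Hartshorne1977] II Ex. 5.1 (b); tree `Modules.dualFrame`):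

* `Modules.nonempty_dual_iso_free_of_iso_free` — for ANY `𝒪_X`-module `E` on a scheme `X` with a global frame
  `E ≅ 𝒪_X^I` (`I` finite), `E^∨ ≅ 𝒪_X^I` (glue the dual frame over `⊤` back to a morphism of modules by ★ `homOfTop`);
* `AbelianVariety.nonempty_tangentSheaf_iso_free` — **`𝒯_{A/k} ≅ 𝒪_A^{Fin (dim A)}`** for every abelian variety over a
  field ([MumfordAV1970] §4 (iii) dualised; [GortzWedhorn2023] Prop. 27.15 / Rem. 27.18 (4): `Lie` and invariant vector
  fields of a group scheme over a field);
* `AbelianVariety.isFiniteLocallyFree_tangentSheaf`, `AbelianVariety.exists_basis_sections_tangentSheaf` — finite local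
  freeness, and compatible `Fin (dim A)`-indexed bases of every `Γ(𝒯_A, V)` over `Γ(𝒪_A, V)` (the global vector
  fields restricted), the input shape of Čech computations with `𝒯_A`-valued cochains.

## References
* [MumfordAV1970] D. Mumford, *Abelian Varieties* (1970), §4 (iii) p. 42 (invariant differentials; `Ω¹` free).
* [Hartshorne1977] R. Hartshorne, *Algebraic Geometry*, GTM 52 (1977), II.8 p. 180 (tangent sheaf `= 𝓗om(Ω, 𝒪)`),
  II Ex. 5.1 (b) p. 123 (duals of locally free sheaves).
* [GortzWedhorn2023] U. Görtz, T. Wedhorn, *Algebraic Geometry II* (2023), Prop. 27.15, Rem. 27.18 (4).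
-/

set_option autoImplicit false

noncomputable section

open CategoryTheory AlgebraicGeometry Opposite TopologicalSpace

universe u

namespace Literature.AlgebraicGeometry.Modules

open Literature.AlgebraicGeometry.Motives

variable {Y : Scheme.{u}} {E : Y.Modules} {I : Type u}

/-- **The dual of a globally free module of finite rank is globally free of the same rank**: a global frame
`E ≅ 𝒪_X^I` (`I` finite) gives `E^∨ = 𝓗om(E, 𝒪_X) ≅ 𝒪_X^I` — the dual frame on the dual basis over the open `⊤`
(★ `dualFrame`), turned back into an isomorphism of `𝒪_X`-modules by ★ `homOfTop` (functorial: `homOfTop_comp`,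
`homOfTop_id`). [cite: Hartshorne1977, II Ex. 5.1 (b) (p. 123)] -/
theorem nonempty_dual_iso_free_of_iso_free [Finite I] (e : E ≅ SheafOfModules.free I) :
    Nonempty (dual E ≅ SheafOfModules.free (R := Y.ringCatSheaf) I) := by
  cases nonempty_fintype I
  obtain ⟨e₀⟩ := nonempty_free_iso_over_of_iso_free e ⊤
  obtain ⟨g₀⟩ := nonempty_free_iso_free_over (Y := Y) ⊤ I
  let ψ : (dual E).over ⊤ ≅ (SheafOfModules.free (R := Y.ringCatSheaf) I).over ⊤ := (dualFrame e₀).symm ≪≫ g₀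
  exact ⟨{ hom := homOfTop ψ.hom
           inv := homOfTop ψ.inv
           hom_inv_id := by rw [← homOfTop_comp, ψ.hom_inv_id, homOfTop_id]
           inv_hom_id := by rw [← homOfTop_comp, ψ.inv_hom_id, homOfTop_id] }⟩

/-- The dual of a globally free module of finite rank is finite locally free.
[cite: Hartshorne1977, II Ex. 5.1 (b) (p. 123)] -/
theorem isFiniteLocallyFree_dual_of_iso_free [Finite I] (e : E ≅ SheafOfModules.free I) :
    IsFiniteLocallyFree (dual E) :=
  isFiniteLocallyFree_dual (isFiniteLocallyFree_of_iso_free e)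

end Literature.AlgebraicGeometry.Modules

namespace Literature.AlgebraicGeometry.Motives

namespace AbelianVariety

open Literature.AlgebraicGeometry.Modules Literature.AlgebraicGeometry.HodgeTheory

variable {k : Type} [Field k] (A : AbelianVariety k)

/-- **The tangent sheaf of an abelian variety is free of rank `dim A`**: `𝒯_{A/k} = 𝓗om(Ω¹_{A/k}, 𝒪_A) ≅ 𝒪_A^{Fin (dim A)}`
— the dual of Mumford's «`Ω¹_X` is a free `𝒪_X`-module generated by the invariant differentials»
(★ `Mumford1970_cotangentSheaf_abelianVariety_free_holds`), i.e. `𝒯_A ≅ 𝒪_A ⊗_k Lie(A)` on the invariant vector fields.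
[cite: MumfordAV1970, §4 (iii) (p. 42)] [cite: GortzWedhorn2023, Prop. 27.15 and Rem. 27.18 (4)]
[cite: Hartshorne1977, II.8 (p. 180) and II Ex. 5.1 (b) (p. 123)] -/
theorem nonempty_tangentSheaf_iso_free :
    Nonempty (tangentSheaf A.X ≅ SheafOfModules.free (R := A.X.left.ringCatSheaf) (Fin A.dim)) := by
  obtain ⟨e⟩ := Mumford1970_cotangentSheaf_abelianVariety_free_holds k A
  exact nonempty_dual_iso_free_of_iso_free e

/-- The tangent sheaf of an abelian variety is finite locally free. [cite: MumfordAV1970, §4 (iii) (p. 42)]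
[cite: Hartshorne1977, II Ex. 5.1 (b) (p. 123)] -/
theorem isFiniteLocallyFree_tangentSheaf : IsFiniteLocallyFree (tangentSheaf A.X) := by
  obtain ⟨e⟩ := Mumford1970_cotangentSheaf_abelianVariety_free_holds k A
  exact isFiniteLocallyFree_dual_of_iso_free e

/-- **Global vector fields frame every module of local sections**: there are `Fin (dim A)`-indexed bases `b_V` of
`Γ(𝒯_A, V)` over `Γ(𝒪_A, V)` for all opens `V`, compatible with restriction (the restrictions of a global frame of
`𝒯_A`; ★ `exists_basis_sections_of_iso_free`).  In particular `Γ(A, 𝒯_A)` is free of rank `dim A` over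
`Γ(A, 𝒪_A)`. [cite: MumfordAV1970, §4 (iii) (p. 42)] [cite: GortzWedhorn2023, Rem. 27.18 (4)] -/
theorem exists_basis_sections_tangentSheaf :
    ∃ b : ∀ V : A.X.left.Opens, Module.Basis (Fin A.dim) Γ(A.X.left, V) Γ(tangentSheaf A.X, V),
      ∀ ⦃V V' : A.X.left.Opens⦄ (l : V' ⟶ V) (i : Fin A.dim),
        (tangentSheaf A.X).presheaf.map l.op (b V i) = b V' i := by
  obtain ⟨e⟩ := nonempty_tangentSheaf_iso_free A
  exact exists_basis_sections_of_iso_free e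

end AbelianVariety

end Literature.AlgebraicGeometry.Motives

end
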